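import Summits.Ventures.PercRepro.ProfilePointedCircuitClassesStarSharpD0X

/-!
# PercRepro — THE ALL-ON CORE OF `StarNineSharp` (THE LOOP REGIME OF D0), PART A: THE SHARED-ENDPOINT LEMMA
(p5, gen 55; `proofs/P5-GM1.md` §82 ADD 1 (e), ADD 2)

In the loop regime (`b ∥ b′` in `N`, every set ON) and in the three parallel regimes, the `b′`-avoiding inequality
reduces to `|bad| ≤ |C|`, where the BAD demands are the pairs `π = {x, y} ⊆ X` with `ρ(π + e) = 3`, `(X − π) + f` a
basis and `π ∉ G_f` (no swap: `ρ(π + f) = 2` — type B2 — or `e ∈ cl(X − π)` — type B1), and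
`C = {x ∈ X : ρ{e, f, x} = 3, ρ(X − x) = 4}`.  Every bad demand has a C-endpoint (`c_point_exists`, D0E).  Here, on
`X = {c, u, v, p, q}`:
* `rk_quad_eq_four_of_B1`: a B1 demand `{c, u}` has `ρ(X − u) = 4` (the endpoint `c ∈ cl{v, p, q} ∋ e` would make
  `E₇ − f − u` of rank 3, against `f` cosimple), so its only possible non-C endpoint lies on the line `ef`;
* `rk_eft_eq_three_of_B2`: a B2 demand `{c, u}` has `ρ{e, f, u} = 3` (`u` on the line `ef` would put `e` on the line
  `cl{c, u} ∋ f`), so its only possible non-C endpoint `u` has `ρ(X − u) = 3`;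
* the set identities and the two absorption lemmas (`not_on_line_ef_of_plane`, `not_rank_four_subset_of_absorb`) used
  by the shared-endpoint lemma of part B.
-/

open scoped Matroid

namespace PercRepro.Cogirth

open Finset ThmH Skew Shadow Profile

open Classical

variable {α : Type} [DecidableEq α] {N : Matroid α} [N.Finite]

section StarSharpLoopA

variable {b b' : α}

/-- `insert e (X.erase x) = (E₇.erase f).erase x` for `x ∈ X`. -/
theorem insert_e_X_erase_eq {e f x : α} (he : e ∈ gr N) (hef : e ≠ f) (heb : e ≠ b) (heb' : e ≠ b')
    (hx : x ∈ ((((gr N).erase b).erase b').erase f).erase e) :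
    insert e ((((((gr N).erase b).erase b').erase f).erase e).erase x) = ((((gr N).erase b).erase b').erase f).erase x := by
  have hxe : x ≠ e := (mem_erase.1 hx).1
  ext a
  constructor
  · intro ha
    rcases mem_insert.1 ha with rfl | ha'
    · exact mem_erase.2 ⟨hxe.symm, mem_erase.2 ⟨hef, mem_erase.2 ⟨heb', mem_erase.2 ⟨heb, he⟩⟩⟩⟩
    · exact mem_erase.2 ⟨(mem_erase.1 ha').1, mem_of_mem_erase (mem_erase.1 ha').2⟩
  · intro ha
    by_cases hae : a = e
    · rw [hae]; exact mem_insert_self _ _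
    · exact mem_insert_of_mem (mem_erase.2 ⟨(mem_erase.1 ha).1, mem_erase.2 ⟨hae, (mem_erase.1 ha).2⟩⟩)

/-- `{c, u, v, p, q}.erase u = {c, v, p, q}`. -/
theorem quint_erase_second {c u v p q : α} (hcu : c ≠ u) (huv : u ≠ v) (hup : u ≠ p) (huq : u ≠ q) :
    ({c, u, v, p, q} : Finset α).erase u = {c, v, p, q} := by
  ext a; simp only [mem_erase, mem_insert, mem_singleton]
  constructor
  · rintro ⟨h1, h2⟩; tauto
  · rintro (rfl | rfl | rfl | rfl)
    · exact ⟨hcu, by tauto⟩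
    · exact ⟨huv.symm, by tauto⟩
    · exact ⟨hup.symm, by tauto⟩
    · exact ⟨huq.symm, by tauto⟩

/-- `{c, u, v, p, q}.erase p = {c, u, v, q}`. -/
theorem quint_erase_fourth {c u v p q : α} (hcp : c ≠ p) (hup : u ≠ p) (hvp : v ≠ p) (hpq : p ≠ q) :
    ({c, u, v, p, q} : Finset α).erase p = {c, u, v, q} := by
  ext a; simp only [mem_erase, mem_insert, mem_singleton]
  constructor
  · rintro ⟨h1, h2⟩; tauto
  · rintro (rfl | rfl | rfl | rfl)
    · exact ⟨hcp, by tauto⟩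
    · exact ⟨hup, by tauto⟩
    · exact ⟨hvp, by tauto⟩
    · exact ⟨hpq.symm, by tauto⟩

/-- `{c, u, v, p, q} = {c, v, u, q, p}`. -/
theorem quint_swap_uv_pq (c u v p q : α) : ({c, u, v, p, q} : Finset α) = {c, v, u, q, p} := by
  ext a; simp only [mem_insert, mem_singleton]; tauto

/-- `{c, u, v, q} ⊆ insert e (insert f {c, u, v, q})`-type: `insert e S ⊆ insert e (insert f S)`. -/
theorem insert_e_subset_insert_e_insert_f (e f : α) (S : Finset α) : insert e S ⊆ insert e (insert f S) :=
  insert_subset_insert _ (subset_insert _ _)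

/-- A pair of a rank-3 triple `insert e {p, q}` has rank 2. -/
theorem rk_pair_eq_two_of_insert_e {e p q : α} (he : e ∈ gr N) (hp : p ∈ gr N) (hq : q ∈ gr N)
    (h3 : rk N (insert e {p, q}) = 3) : rk N {p, q} = 2 := by
  have h1 := rk_insert_le_add_one (N := N) he (X := ({p, q} : Finset α)) (by
    intro a ha; simp only [mem_insert, mem_singleton] at ha; rcases ha with rfl | rfl <;> assumption)
  have h2 := rk_le_card' (M := N) ({p, q} : Finset α)
  have h4 : ({p, q} : Finset α).card ≤ 2 := by
    calc ({p, q} : Finset α).card ≤ ({q} : Finset α).card + 1 := card_insert_le _ _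
      _ = 2 := by rw [card_singleton]
  omega

/-- A triple `T` with `ρ(T + f) = 4` has rank 3. -/
theorem rk_triple_eq_three_of_insert_f {f x y z : α} (hf : f ∈ gr N) (hx : x ∈ gr N) (hy : y ∈ gr N) (hz : z ∈ gr N)
    (h4 : rk N (insert f {x, y, z}) = 4) : rk N {x, y, z} = 3 := by
  have h1 := rk_insert_le_add_one (N := N) hf (X := ({x, y, z} : Finset α)) (by
    intro a ha; simp only [mem_insert, mem_singleton] at ha; rcases ha with rfl | rfl | rfl <;> assumption)
  have h2 := rk_le_card' (M := N) ({x, y, z} : Finset α)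
  have h3 : ({x, y, z} : Finset α).card ≤ 3 := by
    calc ({x, y, z} : Finset α).card ≤ ({y, z} : Finset α).card + 1 := card_insert_le _ _
      _ ≤ ({z} : Finset α).card + 1 + 1 := by gcongr; exact card_insert_le _ _
      _ = 3 := by rw [card_singleton]
  omega

/-- **A B1 DEMAND `{c, u}` HAS `ρ(X − u) = 4`** (`X = {c, u, v, p, q}`, `(X − π) + f` a basis, `e ∈ cl{v, p, q}`):
`c ∈ cl{v, p, q}` would make `E₇ − f − u = {c, v, p, q} + e` of rank 3. -/
theorem rk_quad_eq_four_of_B1 {e f : α} (he : e ∈ gr N) (hf : f ∈ gr N) (hef : e ≠ f) (heb : e ≠ b) (heb' : e ≠ b')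
    (hfc : ∀ y ∈ ((((gr N).erase b).erase b').erase f).erase e, rk N (((((gr N).erase b).erase b').erase f).erase y) = 4)
    {c u v p q : α} (hcu : c ≠ u) (huv : u ≠ v) (hup : u ≠ p) (huq : u ≠ q)
    (hu : u ∈ ((((gr N).erase b).erase b').erase f).erase e)
    (hXeq : ((((gr N).erase b).erase b').erase f).erase e = {c, u, v, p, q})
    (hYc : rk N (insert f {v, p, q}) = 4) (hB1 : rk N (insert e {v, p, q}) = 3) :
    rk N ({c, v, p, q} : Finset α) = 4 := by
  have hE7g : ((gr N).erase b).erase b' ⊆ gr N := (erase_subset _ _).trans (erase_subset _ _)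
  have hXg : ((((gr N).erase b).erase b').erase f).erase e ⊆ gr N :=
    ((erase_subset _ _).trans (erase_subset _ _)).trans hE7g
  have hvg : v ∈ gr N := hXg (by rw [hXeq]; exact mem_insert_of_mem (mem_insert_of_mem (mem_insert_self _ _)))
  have hpg : p ∈ gr N := hXg (by
    rw [hXeq]; exact mem_insert_of_mem (mem_insert_of_mem (mem_insert_of_mem (mem_insert_self _ _))))
  have hqg : q ∈ gr N := hXg (by
    rw [hXeq]
    exact mem_insert_of_mem (mem_insert_of_mem (mem_insert_of_mem (mem_insert_of_mem (mem_singleton_self _)))))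
  have h4 : rk N (insert e ({c, v, p, q} : Finset α)) = 4 := by
    have := hfc u hu
    rw [← insert_e_X_erase_eq he hef heb heb' hu, hXeq, quint_erase_second hcu huv hup huq] at this
    exact this
  have h3 := rk_triple_eq_three_of_insert_f hf hvg hpg hqg hYc
  by_contra hne
  have hle : rk N ({c, v, p, q} : Finset α) ≤ 3 := by
    have h1 := rk_le_card' (M := N) ({c, v, p, q} : Finset α)
    have h2 : ({c, v, p, q} : Finset α).card ≤ 4 := by
      calc ({c, v, p, q} : Finset α).card ≤ ({v, p, q} : Finset α).card + 1 := card_insert_le _ _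
        _ ≤ ({p, q} : Finset α).card + 1 + 1 := by gcongr; exact card_insert_le _ _
        _ ≤ ({q} : Finset α).card + 1 + 1 + 1 := by gcongr; exact card_insert_le _ _
        _ = 4 := by rw [card_singleton]
    omega
  -- `c ∈ cl{v, p, q}` and `e ∈ cl{v, p, q}`
  have hc' : rk N (insert c ({v, p, q} : Finset α)) = rk N ({v, p, q} : Finset α) := by
    have : rk N ({v, p, q} : Finset α) ≤ rk N (insert c ({v, p, q} : Finset α)) := rk_mono' (subset_insert _ _)
    omega
  have he' : rk N (insert e ({v, p, q} : Finset α)) = rk N ({v, p, q} : Finset α) := by rw [hB1, h3]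
  have h5 := rk_insert_eq_of_rk_insert_eq_subset' (N := N) (S := ({v, p, q} : Finset α))
    (S' := insert c ({v, p, q} : Finset α)) (w := e) (subset_insert _ _) he'
  rw [hc', h3] at h5
  rw [h5] at h4
  omega

/-- **A B2 DEMAND `{c, u}` HAS `ρ{e, f, u} = 3`** (`ρ(π + e) = 3`, `f ∈ cl(π)`): `u` on the line `ef` would put
`e ∈ cl{f, u} ⊆ cl(π + f) = cl(π)`. -/
theorem rk_eft_eq_three_of_B2 {e f : α} (he : e ∈ gr N) (hf : f ∈ gr N)
    (hf1 : ∀ y ∈ ((((gr N).erase b).erase b').erase f).erase e, rk N {f, y} = 2) (hef2 : rk N {e, f} = 2)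
    {c u : α} (hu : u ∈ ((((gr N).erase b).erase b').erase f).erase e) (hY : rk N (insert e {c, u}) = 3)
    (hB2 : rk N (insert f {c, u}) = 2) : rk N {e, f, u} = 3 := by
  have hE7g : ((gr N).erase b).erase b' ⊆ gr N := (erase_subset _ _).trans (erase_subset _ _)
  have hug : u ∈ gr N := hE7g ((erase_subset _ _).trans (erase_subset _ _) hu)
  by_contra hne
  have h2 : rk N ({e, f, u} : Finset α) = 2 := by
    have h1 : rk N ({e, f} : Finset α) ≤ rk N ({e, f, u} : Finset α) := rk_mono' (pair_ef_subset_eft e f u)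
    have h3 := rk_insert_le_add_one (N := N) hug (X := ({e, f} : Finset α)) (by
      intro a ha; simp only [mem_insert, mem_singleton] at ha; rcases ha with rfl | rfl <;> assumption)
    rw [← triple_eq_insert_last] at h3
    rw [hef2] at h1 h3
    omega
  -- `e ∈ cl{f, u}`
  have h1 : rk N (insert e ({f, u} : Finset α)) = rk N ({f, u} : Finset α) := by
    rw [insert_pair_eq_first, h2, hf1 u hu]
  -- `{f, u} ⊆ insert f {c, u}` of rank 2
  have h3 := rk_insert_eq_of_rk_insert_eq_subset' (N := N) (S := ({f, u} : Finset α))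
    (S' := insert f ({c, u} : Finset α)) (w := e) (pair_subset_insert_pair' f c u) h1
  have h4 : rk N (insert e ({c, u} : Finset α)) ≤ rk N (insert e (insert f ({c, u} : Finset α))) :=
    rk_mono' (insert_subset_insert _ (subset_insert _ _))
  rw [hY, h3, hB2] at h4
  omega


/-- `{c, u, v, p, q}.erase q = {c, u, v, p}`. -/
theorem quint_erase_fifth {c u v p q : α} (hcq : c ≠ q) (huq : u ≠ q) (hvq : v ≠ q) (hpq : p ≠ q) :
    ({c, u, v, p, q} : Finset α).erase q = {c, u, v, p} := by
  ext a; simp only [mem_erase, mem_insert, mem_singleton]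
  constructor
  · rintro ⟨h1, h2⟩; tauto
  · rintro (rfl | rfl | rfl | rfl)
    · exact ⟨hcq, by tauto⟩
    · exact ⟨huq, by tauto⟩
    · exact ⟨hvq, by tauto⟩
    · exact ⟨hpq, by tauto⟩

/-- `{c, u, q, p} = {c, u, p, q}`. -/
theorem quad_swap34 (c u p q : α) : ({c, u, q, p} : Finset α) = {c, u, p, q} := by
  ext a; simp only [mem_insert, mem_singleton]; tauto

/-- `{c, v} ⊆ {c, u, v, q}`. -/
theorem pair_cv_subset_quad (c u v q : α) : ({c, v} : Finset α) ⊆ {c, u, v, q} := by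
  intro a ha; simp only [mem_insert, mem_singleton] at ha ⊢; tauto

/-- `{c, u} ⊆ {c, u, v, q}`. -/
theorem pair_cu_subset_quad (c u v q : α) : ({c, u} : Finset α) ⊆ {c, u, v, q} := by
  intro a ha; simp only [mem_insert, mem_singleton] at ha ⊢; tauto

/-- `{f, u} ⊆ insert f {c, u, v, q}`. -/
theorem pair_fu_subset_insert_f_quad (f c u v q : α) : ({f, u} : Finset α) ⊆ insert f {c, u, v, q} := by
  intro a ha; simp only [mem_insert, mem_singleton] at ha ⊢; tauto

/-- `{f, v} ⊆ insert f {c, u, v, q}`. -/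
theorem pair_fv_subset_insert_f_quad (f c u v q : α) : ({f, v} : Finset α) ⊆ insert f {c, u, v, q} := by
  intro a ha; simp only [mem_insert, mem_singleton] at ha ⊢; tauto

/-- `{e, p} ⊆ insert e {v, p, q}`. -/
theorem pair_ep_subset_insert_e_triple (e v p q : α) : ({e, p} : Finset α) ⊆ insert e {v, p, q} := by
  intro a ha; simp only [mem_insert, mem_singleton] at ha ⊢; tauto

/-- `{e, q} ⊆ insert e {v, p, q}`. -/
theorem pair_eq_subset_insert_e_triple (e v p q : α) : ({e, q} : Finset α) ⊆ insert e {v, p, q} := by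
  intro a ha; simp only [mem_insert, mem_singleton] at ha ⊢; tauto

/-- `{c, f} ⊆ insert f {c, u, p, q}`. -/
theorem pair_cf_subset_insert_f_quad (f c u p q : α) : ({c, f} : Finset α) ⊆ insert f {c, u, p, q} := by
  intro a ha; simp only [mem_insert, mem_singleton] at ha ⊢; tauto

/-- `insert f {v, p, q} ⊆ insert v (insert f {c, u, p, q})`. -/
theorem insert_f_triple_subset (f c u v p q : α) :
    insert f ({v, p, q} : Finset α) ⊆ insert v (insert f {c, u, p, q}) := by
  intro a ha; simp only [mem_insert, mem_singleton] at ha ⊢; tauto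

/-- `insert f {u, p, q} ⊆ insert u (insert f {c, v, p, q})`. -/
theorem insert_f_triple_subset' (f c u v p q : α) :
    insert f ({u, p, q} : Finset α) ⊆ insert u (insert f {c, v, p, q}) := by
  intro a ha; simp only [mem_insert, mem_singleton] at ha ⊢; tauto

/-- A point `p` of a rank-3 set `T + e` on the line `ef` puts `f` into `cl(T + e)`, against `ρ(T + f) = 4`. -/
theorem not_on_line_ef_of_plane {e f p : α} {T : Finset α} (hT3 : rk N (insert e T) = 3) (hTf : rk N (insert f T) = 4)
    (hpT : ({e, p} : Finset α) ⊆ insert e T) (hep : rk N {e, p} = 2) (hefp : rk N {e, f, p} = 2) : False := by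
  have h1 : rk N (insert f ({e, p} : Finset α)) = rk N ({e, p} : Finset α) := by
    rw [insert_pair_eq_mid, hefp, hep]
  have h2 := rk_insert_eq_of_rk_insert_eq_subset' (N := N) (S := ({e, p} : Finset α)) (S' := insert e T) (w := f)
    hpT h1
  have h3 : rk N (insert f T) ≤ rk N (insert f (insert e T)) := rk_mono' (insert_subset_insert _ (subset_insert _ _))
  rw [hTf, h2, hT3] at h3
  omega

/-- If `f ∈ cl(S)` and `e ∈ cl(S + f)` then `S + e + f` has the rank of `S`; a rank-4 subset of it is impossible when
`ρ(S) ≤ 3`. -/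
theorem not_rank_four_subset_of_absorb {e f : α} {S E : Finset α} (hS3 : rk N S ≤ 3)
    (hfS : rk N (insert f S) = rk N S) (heS : rk N (insert e (insert f S)) = rk N (insert f S))
    (hE : rk N E = 4) (hEsub : E ⊆ insert e (insert f S)) : False := by
  have h1 : rk N E ≤ rk N (insert e (insert f S)) := rk_mono' hEsub
  omega

end StarSharpLoopA

end PercRepro.Cogirth
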